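import Summits.Ventures.PercRepro.C026ForestBound

/-!
# The terminal count: a reduced instance with at most one cycle has at most five live vertices
(p6, gen 12)

`proofs/P6-unicyclic.md` §2: if no reduction step applies — no loop, no parallel pair, every non-mark
of degree `0` or `≥ 3`, the mark `c` not of degree `1` — and the multigraph has at most one cycle,
then the vertices that matter (the marks and the endpoints of the edges) number at most `5`:

* `card_le_card_suppOn` — `|E| ≤ |W|` (the forest bound on `E` minus the special edge);
* `sum_edgeDeg_suppOn` — the handshake restricted to `W`;
* **`card_supp_le_five`**: with `U` the non-marks of `W`, `3|U| + 2|W_c| + |W_ab| ≤ Σ_W deg = 2|E|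
  ≤ 2|W| = 2(|U| + |W_c| + |W_ab|)` gives `|U| ≤ |W_ab| ≤ 2`, and the support is `U ∪ {a, b, c}`.
-/

namespace PercRepro

open Finset

namespace MultiGraph

section Count

variable {V E : Type*} [Fintype V] [Fintype E] [DecidableEq V] [DecidableEq E]
  {G : MultiGraph V E}

omit [Fintype V] [DecidableEq V] in
/-- The edges of an acyclic-away multigraph, minus the special edge, are acyclic. -/
theorem AcyclicAway.acyclicSet_erase {f : E} (h : G.AcyclicAway (some f)) :
    G.AcyclicSet (univ.erase f) := by
  intro e he
  have hef : e ≠ f := (Finset.mem_erase.mp he).1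
  refine h _ ?_ e ?_ (Function.update_self _ _ _)
  · intro g hg
    rw [Option.mem_def, Option.some_inj] at hg
    subst hg
    rw [Function.update_of_ne (Ne.symm hef)]
    simp [openOn]
  · intro hh
    exact hef (Option.some.inj hh)

omit [Fintype V] [DecidableEq V] in
/-- An acyclic multigraph has every edge set acyclic. -/
theorem AcyclicAway.acyclicSet_univ (h : G.AcyclicAway none) : G.AcyclicSet univ := by
  intro e _
  refine h _ (fun g hg => by simp at hg) e (by simp) (Function.update_self _ _ _)

/-- **`|E| ≤ |W|`** for a multigraph with at most one cycle (`W` = the endpoints of the edges). -/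
theorem card_le_card_suppOn (h : G.AtMostOneCycle) :
    Fintype.card E ≤ (G.suppOn univ).card := by
  obtain ⟨e₀, h⟩ := h
  cases e₀ with
  | none =>
    rcases (univ : Finset E).eq_empty_or_nonempty with hE | hE
    · rw [← Finset.card_univ, hE, Finset.card_empty]
      exact Nat.zero_le _
    · have := card_add_one_le_card_suppOn h.acyclicSet_univ hE
      rw [Finset.card_univ] at this
      omega
  | some f =>
    rcases (univ.erase f).eq_empty_or_nonempty with hE | hE
    · have h1 : Fintype.card E = 1 := by
        have := Finset.card_erase_add_one (Finset.mem_univ f)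
        rw [hE, Finset.card_empty, Finset.card_univ] at this
        omega
      rw [h1]
      refine Finset.card_pos.mpr ⟨G.fst f, ?_⟩
      simp only [suppOn, Finset.mem_filter, Finset.mem_univ, true_and]
      exact ⟨f, Or.inl rfl⟩
    · have h1 := card_add_one_le_card_suppOn h.acyclicSet_erase hE
      have h2 := Finset.card_erase_add_one (Finset.mem_univ f)
      rw [Finset.card_univ] at h2
      have h3 : G.suppOn (univ.erase f) ⊆ G.suppOn univ := by
        intro v hv
        simp only [suppOn, Finset.mem_filter, Finset.mem_univ, true_and] at hv ⊢
        obtain ⟨e, _, he⟩ := hv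
        exact ⟨e, he⟩
      have h4 := Finset.card_le_card h3
      omega

omit [DecidableEq E] in
/-- A vertex outside `W` has degree `0`. -/
theorem edgeDeg_eq_zero_of_notMem {v : V} (hv : v ∉ G.suppOn univ) : G.edgeDeg v = 0 := by
  unfold edgeDeg
  rw [Finset.card_eq_zero, Finset.filter_eq_empty_iff]
  intro e _ he
  apply hv
  simp only [suppOn, Finset.mem_filter, Finset.mem_univ, true_and]
  exact ⟨e, he⟩

omit [DecidableEq E] in
/-- A vertex of `W` has positive degree. -/
theorem one_le_edgeDeg_of_mem {v : V} (hv : v ∈ G.suppOn univ) : 1 ≤ G.edgeDeg v := by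
  simp only [suppOn, Finset.mem_filter, Finset.mem_univ, true_and] at hv
  obtain ⟨e, he⟩ := hv
  unfold edgeDeg
  exact Finset.card_pos.mpr ⟨e, by simpa using he⟩

omit [DecidableEq E] in
/-- The handshake restricted to `W`. -/
theorem sum_edgeDeg_suppOn (hl : ∀ e, G.fst e ≠ G.snd e) :
    ∑ v ∈ G.suppOn univ, G.edgeDeg v = 2 * Fintype.card E := by
  rw [← G.sum_edgeDeg hl]
  refine Finset.sum_subset (Finset.subset_univ _) fun v _ hv => ?_
  exact edgeDeg_eq_zero_of_notMem hv

/-- The lower bound on a degree in a reduced instance: `1` at `a, b`, `2` at `c`, `3` elsewhere. -/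
def degLB (a b c : V) (v : V) : ℕ := if v = a ∨ v = b then 1 else if v = c then 2 else 3

/-- **The terminal count**: in a reduced instance with at most one cycle the support has at most
five vertices. -/
theorem card_supp_le_five (hl : ∀ e, G.fst e ≠ G.snd e) (a b c : V)
    (hnm : ∀ v, v ≠ a → v ≠ b → v ≠ c → G.edgeDeg v = 0 ∨ 3 ≤ G.edgeDeg v)
    (hc : G.edgeDeg c ≠ 1) (h : G.AtMostOneCycle) :
    (univ.filter fun v => v = a ∨ v = b ∨ v = c ∨ ∃ e, G.fst e = v ∨ G.snd e = v).card ≤ 5 := by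
  set W := G.suppOn univ with hW
  set U := W.filter fun v => ¬ (v = a ∨ v = b) ∧ v ≠ c with hU
  set Wc := W.filter fun v => ¬ (v = a ∨ v = b) ∧ v = c with hWc
  set Wab := W.filter fun v => v = a ∨ v = b with hWab
  -- the three pieces of `W`
  have hsplit : W.card = Wab.card + (Wc.card + U.card) := by
    rw [hWab, hWc, hU]
    rw [← Finset.card_filter_add_card_filter_not (fun v => v = a ∨ v = b)]
    congr 1
    rw [← Finset.card_filter_add_card_filter_not (fun v => v = c)]
    congr 1
    · rw [Finset.filter_filter]
    · rw [Finset.filter_filter]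
  -- the degree sum over `W` is at least the weighted count
  have hlb : ∀ v ∈ W, degLB a b c v ≤ G.edgeDeg v := by
    intro v hv
    have h1 := one_le_edgeDeg_of_mem (G := G) hv
    unfold degLB
    split_ifs with hab hvc
    · exact h1
    · subst hvc
      omega
    · rcases hnm v (fun h => hab (Or.inl h)) (fun h => hab (Or.inr h)) hvc with h0 | h3
      · omega
      · exact h3
  have hsumLB : ∑ v ∈ W, degLB a b c v ≤ ∑ v ∈ W, G.edgeDeg v := Finset.sum_le_sum hlb
  have hsumLB' : ∑ v ∈ W, degLB a b c v = Wab.card + (2 * Wc.card + 3 * U.card) := by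
    rw [← Finset.sum_filter_add_sum_filter_not W (fun v => v = a ∨ v = b)]
    rw [← Finset.sum_filter_add_sum_filter_not (W.filter fun v => ¬ (v = a ∨ v = b)) (fun v => v = c)]
    rw [Finset.filter_filter, Finset.filter_filter]
    have e1 : ∑ v ∈ Wab, degLB a b c v = Wab.card := by
      rw [Finset.card_eq_sum_ones]
      refine Finset.sum_congr rfl fun v hv => ?_
      have := (Finset.mem_filter.mp hv).2
      simp [degLB, this]
    have e2 : ∑ v ∈ Wc, degLB a b c v = 2 * Wc.card := by
      rw [Finset.card_eq_sum_ones, Finset.mul_sum]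
      refine Finset.sum_congr rfl fun v hv => ?_
      obtain ⟨h1, h2⟩ := (Finset.mem_filter.mp hv).2
      rw [h2] at h1 ⊢
      simp [degLB, h1]
    have e3 : ∑ v ∈ U, degLB a b c v = 3 * U.card := by
      rw [Finset.card_eq_sum_ones, Finset.mul_sum]
      refine Finset.sum_congr rfl fun v hv => ?_
      obtain ⟨h1, h2⟩ := (Finset.mem_filter.mp hv).2
      simp [degLB, h1, h2]
    rw [hWab] at e1
    rw [hWc] at e2
    rw [hU] at e3
    rw [e1, e2, e3]
  have hhand : ∑ v ∈ W, G.edgeDeg v = 2 * Fintype.card E := sum_edgeDeg_suppOn (G := G) hl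
  have hEW : Fintype.card E ≤ W.card := card_le_card_suppOn h
  -- the support is `U ∪ {a, b, c}`
  have hsub : (univ.filter fun v => v = a ∨ v = b ∨ v = c ∨ ∃ e, G.fst e = v ∨ G.snd e = v) ⊆
      U ∪ {a, b, c} := by
    intro v hv
    simp only [Finset.mem_filter, Finset.mem_univ, true_and] at hv
    rw [Finset.mem_union, Finset.mem_insert, Finset.mem_insert, Finset.mem_singleton]
    by_cases hm : v = a ∨ v = b ∨ v = c
    · exact Or.inr hm
    · left
      rcases hv with h | h | h | ⟨e, he⟩
      · exact absurd (Or.inl h) hm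
      · exact absurd (Or.inr (Or.inl h)) hm
      · exact absurd (Or.inr (Or.inr h)) hm
      · rw [hU]
        refine Finset.mem_filter.mpr ⟨?_, fun h' => hm ?_, fun h' => hm (Or.inr (Or.inr h'))⟩
        · simp only [hW, suppOn, Finset.mem_filter, Finset.mem_univ, true_and]
          exact ⟨e, he⟩
        · rcases h' with h' | h'
          · exact Or.inl h'
          · exact Or.inr (Or.inl h')
  have hcard := Finset.card_le_card hsub
  have hU3 := Finset.card_union_le U ({a, b, c} : Finset V)
  have habc : ({a, b, c} : Finset V).card ≤ 3 := Finset.card_le_three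
  have hWab2 : Wab.card ≤ 2 := by
    have : Wab ⊆ {a, b} := by
      intro v hv
      have := (Finset.mem_filter.mp hv).2
      simp only [Finset.mem_insert, Finset.mem_singleton]
      exact this
    exact (Finset.card_le_card this).trans Finset.card_le_two
  omega

end Count

end MultiGraph

end PercRepro
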